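import Literature.MathematicalPhysics.QuantumFieldTheory.Balaban1983to89.B9Eq349BlockDistanceWeight
import Literature.MathematicalPhysics.QuantumFieldTheory.Balaban1983to89.B9Eq349BlockMultipliers
import Literature.MathematicalPhysics.QuantumFieldTheory.Balaban1983to89.B9Eq3101CommutatorCauchyBlockDecay
import Literature.MathematicalPhysics.QuantumFieldTheory.Balaban1983to89.B9Eq387IMSLocalLettersLattice
import Literature.MathematicalPhysics.QuantumFieldTheory.Balaban1983to89.B9Eq316TowerFlatIsOneStep
import Literature.MathematicalPhysics.QuantumFieldTheory.Balaban1983to89.B11Eq103H1Complex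

/-!
# `Balaban1983to89.B9Eq349BondBlockDecayFromCircle` — T. Bałaban, *Propagators for lattice gauge theories in a background field*, Commun. Math. Phys. **99**
# (1985) 389–434 [Balaban1985BackgroundPropagators] (3.49) p. 399, (3.101) p. 414, Thm 3.11 p. 416: **BLOCK DECAY, FINE BONDS TO FINE BONDS, FROM A UNIFORM
# CIRCLE LETTER WITH A COMPANION COARSE WEIGHT** — the bond twin of this lineage's `B9Eq349BondPointDecayFromCircle` (coarse-bond POINTS) and of the OWNER
# lineage t4-ne9-p1's (D0-d) `B9Eq326LocalPartBlockDecay` §2 `norm_block_le_exp_of_uniform_circle_bound_bonds` (fine-bond BLOCKS, NO companion; g92, staged —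
# CREDIT: §1's proof text is theirs with the companion threaded through), itself the twin of ne9-leaf-06's `B9Eq349ConjugatedGreenBlockDecay.…_sites`: an operator
# `T` on `L²(Bond T_{L·m}; c₀)`, the bond-block family `P_y` (`π(b) = blockCoord(b₋)`), and ONE bound `C` on `‖e^{κM_B} ∘ T ∘ e^{−κM_B}‖` holding for EVERY fine
# site weight `χ` with bond increments `≤ ι` (`ι ≥ 1∕L`), EVERY coarse companion `χ′` with `|χ′(y) − χ(x)| ≤ ℓ′` on the block of `y` (`ℓ′ ≥ 1`), `M_B` the bond
# multiplier by `χ(b₋)`, and every `κ` on the circle `‖κ‖ = r` ⟹ `‖P_{y₁} ∘ T ∘ P_{y₀}‖ ≤ C·e^{r}·e^{−r·d_m(y₀,y₁)}` — the pair weight of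
# `B9Eq349BlockDistanceWeight.exists_pairWeight` read at the block centres supplies BOTH `χ` and `χ′ := χ ∘ centre`; the companion is what the conjugated
# `Q(U)` letters of road ΔA-CT quantify over (`B9Eq3126QG1QInvPointDecay`'s `hQK`), so the `G₁(U)` block-decay END can be stated on the SAME letters as the
# `(QG₁Q*)⁻¹` point-decay END and composed into the `H₁` row (`B9Eq3126H1BlockDecayOfLetters`)

statement-level skeleton of published theorems with citation tags; proofs where landed; nothing here is a claim about the Yang–Mills mass gap

CITATION HEADER (lean-in-tree rule).  Audit cell `pub-balaban`, sub-cell `t4`, BINDER row NE9 (road ΔA-CT of the NE9 formalisation swarm, leaf prover 03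
`b2b-balaban-t4-ne9-formalise-leaf-03` gen 76).  Imports BY NAME (all BUILT): `B9Eq349BlockDistanceWeight.exists_pairWeight` (ne9-leaf-01),
`B9Eq349BlockMultipliers` (ne9-leaf-01), `B9Eq3101CommutatorCauchyBlockDecay.norm_block_le_of_conj_bound_abs` (ne9-leaf-06), `B9Eq387IMSLocalLettersLattice.exists_pointwise_clm`,
`B9Eq316TowerFlatIsOneStep.siteCast` (§2's typing transport).  Sources READ first-hand: [Balaban1985BackgroundPropagators] p. 399 (3.49) («e^{−δ₀d(y,y′)} for x ∈ Δ(y),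
x′ ∈ Δ(y′)» — print's rate `δ₀` NOT asserted; the rate is the caller's circle radius), p. 414 (3.101) (the analyticity ∕ conjugation device), p. 416 Thm 3.11.

WHAT IS PROVED (sorry-free; proof lane — no `def`; [folklore] Combes–Thomas ∕ Agmon read-out).
* §1 **`norm_bondBlock_le_exp_of_uniform_circle_bound`** — the read-out above on the one-step fine torus `TSite d (fineP L m)`.
* §2 **`norm_bondBlock_le_exp_of_uniform_circle_bound_cast`** — the same on any typing `P = fineP N m` of the fine torus (`B9Eq316TowerFlatIsOneStep.towerP_eq_fineP_pow`
  for the tower road), the block condition read through `siteCast h`.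
HONEST SCOPE.  Abstract operator `T`, abstract constant `C`, radius `r` = the caller's; nothing of print asserted; NOT NE9 (cell pub-balaban: NE9 NOT PRINTED ∕
NOT PROVED; «NE9 ⇐ the named binders»; row WALLED ON A MODEL (O-NE9-1; #5 UNRULED); spine PROVED 0∕9; rung (B)+1 on a finite T⁴ — NOT infinite volume, NOT
mass gap, NOT BetaPertH, NOT Clay; HONEST DEPENDENCY: continuum YM on T⁴ ⇐ BetaPertH ∧ nine spine estimates (0/9 proved); BetaPertH ⇐ (D1) ∧ (D4) ∧
CAP+tail).  NEW file; nothing modified.  Net new unproved facts: 0.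
-/

noncomputable section

open scoped InnerProductSpace ComplexConjugate
open NormedSpace

namespace Literature.MathematicalPhysics.QuantumFieldTheory.Balaban1983to89.B9Eq349BondBlockDecayFromCircle

open B4Sect5Torus (TSite tdist)
open B9SectCLatticeCarrier (Bond bpos btgt)
open B9Eq311L2Pairing (WL2)
open B9Eq319QprimeTorus (fineP blockCoord centre blockCoord_centre)
open B9Eq316TowerFlatIsOneStep (siteCast siteCast_rfl)
open B11Eq103H1Complex (BondL2K)
open B9Eq387IMSLocalLettersLattice (exists_pointwise_clm)
open B9Eq349BlockDistanceWeight (exists_pairWeight)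
open B9Eq349BlockMultipliers (mul_comp_block_eq_smul block_comp_mul_eq_smul opNorm_block_le)
open B9Eq3101CommutatorCauchyBlockDecay (norm_block_le_of_conj_bound_abs)

variable {d : ℕ} (L : ℕ) [NeZero L] (m : Fin d → ℕ) {W : Type*} [NormedAddCommGroup W] [InnerProductSpace ℂ W] [FiniteDimensional ℂ W]
  {c₀ : ℝ} [Fact (0 < c₀)]

/-! ## §1 Block decay on the fine bonds from a uniform circle letter with companion -/

/-- **BLOCK DECAY, FINE BONDS TO FINE BONDS, FROM A UNIFORM CIRCLE LETTER WITH COMPANION**: `T : L²(fine bonds) → L²(fine bonds)`, the bond blocks `P_y`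
(`π(b) = blockCoord(b₋)`), and ONE bound `C` on `‖e^{κM_B} ∘ T ∘ e^{−κM_B}‖` for every fine site weight `χ` with bond increments `≤ ι` (`ι ≥ 1∕L`), every coarse
companion `χ′` with `|χ′(y) − χ(x)| ≤ ℓ′` on the block of `y` (`ℓ′ ≥ 1`), `M_B` the bond multiplier by `χ(b₋)`, and every `‖κ‖ = r` ⟹
`‖P_{y₁} ∘ T ∘ P_{y₀}‖ ≤ C·e^{r}·e^{−r·d_m(y₀,y₁)}` (pair weight of `B9Eq349BlockDistanceWeight` at `κ = ±r`, companion `χ ∘ centre`, (K1)'s eigen-relations on the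
bond blocks, the Cauchy kernel of `B9Eq3101CommutatorCauchyBlockDecay`). [folklore] (Combes–Thomas ∕ Agmon conjugation; proof text = t4-ne9-p1 g92's (D0-d) §2 with the
companion threaded through — CREDIT) [cite: Balaban1985BackgroundPropagators, (3.49) p.399, (3.101) p.414, Thm 3.11 p.416] -/
theorem norm_bondBlock_le_exp_of_uniform_circle_bound (hm : ∀ i, 1 ≤ m i)
    (T : BondL2K ℂ d (fineP L m) c₀ W →L[ℂ] BondL2K ℂ d (fineP L m) c₀ W)
    {PB : TSite d m → BondL2K ℂ d (fineP L m) c₀ W →L[ℂ] BondL2K ℂ d (fineP L m) c₀ W}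
    (hPB : ∀ (y : TSite d m) (f : BondL2K ℂ d (fineP L m) c₀ W) (b : Bond d (fineP L m)),
      WL2.equiv ℂ (fun _ : Bond d (fineP L m) => c₀) W (PB y f) b =
        if blockCoord L m (bpos b) = y then WL2.equiv ℂ (fun _ : Bond d (fineP L m) => c₀) W f b else 0)
    {r C ι ℓ' : ℝ} (hr : 0 ≤ r) (hC0 : 0 ≤ C) (hι : 1 / (L : ℝ) ≤ ι) (hℓ' : 1 ≤ ℓ')
    (hC : ∀ (χ : TSite d (fineP L m) → ℝ) (χ' : TSite d m → ℝ),
      (∀ b : Bond d (fineP L m), |χ (bpos b) - χ (btgt b)| ≤ ι) →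
      (∀ (y : TSite d m), ∀ x ∈ B9Eq319QprimeTorus.blockOf L m y, |χ' y - χ x| ≤ ℓ') →
      ∀ (MB : BondL2K ℂ d (fineP L m) c₀ W →L[ℂ] BondL2K ℂ d (fineP L m) c₀ W),
      (∀ (f : BondL2K ℂ d (fineP L m) c₀ W) (b : Bond d (fineP L m)),
        WL2.equiv ℂ (fun _ : Bond d (fineP L m) => c₀) W (MB f) b = (χ (bpos b) : ℂ) • WL2.equiv ℂ (fun _ : Bond d (fineP L m) => c₀) W f b) →
      ∀ κ : ℂ, ‖κ‖ = r → ‖exp (κ • MB) ∘L T ∘L exp (κ • (-MB))‖ ≤ C)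
    (y₀ y₁ : TSite d m) :
    ‖PB y₁ ∘L T ∘L PB y₀‖ ≤ C * Real.exp r * Real.exp (-(r * tdist m y₀ y₁)) := by
  classical
  obtain ⟨χ, -, hχA, hχB, hχbond, -, hχcentre, hDlo, -⟩ := exists_pairWeight (L := L) hm y₀ y₁
  set D : ℝ := max 0 ((L : ℝ) * tdist m y₀ y₁ - ((L : ℝ) - 1)) with hD
  obtain ⟨MB, hMB⟩ := exists_pointwise_clm (𝕜 := ℂ) (w := fun _ : Bond d (fineP L m) => c₀) (V := W) (fun b : Bond d (fineP L m) => bpos b) χ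
  have hCχ := hC χ (fun y => χ (centre L m y)) (fun b => (hχbond b).trans hι) (fun y x hx => (hχcentre y x hx).trans hℓ') MB hMB
  have hκp : ‖((r : ℝ) : ℂ)‖ = r := by rw [Complex.norm_real, Real.norm_eq_abs, abs_of_nonneg hr]
  have hκm : ‖((-r : ℝ) : ℂ)‖ = r := by rw [Complex.norm_real, Real.norm_eq_abs, abs_neg, abs_of_nonneg hr]
  have hp : MB ∘L PB y₀ = (((0 : ℝ) : ℂ)) • PB y₀ :=
    mul_comp_block_eq_smul (π := fun b : Bond d (fineP L m) => blockCoord L m (bpos b)) hPB hMB y₀ _ fun b hb => by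
      show ((χ (bpos b) : ℝ) : ℂ) = ((0 : ℝ) : ℂ)
      rw [hχA (bpos b) hb]
  have hq : PB y₁ ∘L MB = (((D / L : ℝ)) : ℂ) • PB y₁ :=
    block_comp_mul_eq_smul (π := fun b : Bond d (fineP L m) => blockCoord L m (bpos b)) hPB hMB y₁ _ fun b hb => by
      show ((χ (bpos b) : ℝ) : ℂ) = ((D / L : ℝ) : ℂ)
      rw [hχB (bpos b) hb]
  have h := norm_block_le_of_conj_bound_abs MB MB T (PB y₀) (PB y₁) 0 (D / L) r hp hq (hCχ _ hκp) (hCχ _ hκm)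
  have hDL : 0 ≤ D / L := div_nonneg (le_max_left _ _) (Nat.cast_nonneg _)
  rw [sub_zero, abs_of_nonneg hDL] at h
  have h1 : ‖PB y₁ ∘L T ∘L PB y₀‖ ≤ Real.exp (-(r * (D / L))) * C := by
    refine h.trans (mul_le_mul_of_nonneg_left ?_ (Real.exp_pos _).le)
    calc ‖PB y₁‖ * C * ‖PB y₀‖ ≤ 1 * C * 1 := by
          gcongr
          · exact opNorm_block_le hPB y₁
          · exact opNorm_block_le hPB y₀
      _ = C := by ring
  refine h1.trans ?_
  rw [mul_comm, mul_assoc, ← Real.exp_add]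
  refine mul_le_mul_of_nonneg_left (Real.exp_le_exp.mpr ?_) hC0
  have hDL' : tdist m y₀ y₁ - 1 ≤ D / L := hDlo
  nlinarith

/-! ## §2 The same on any typing `P = fineP N m` of the fine torus -/

/-- **… ON ANY TYPING `P = fineP N m` OF THE FINE TORUS** (`h`, e.g. `B9Eq316TowerFlatIsOneStep.towerP_eq_fineP_pow` for the tower at `N = L^{n+1}`): fine weights
on `TSite d P` with bond increments `≤ ι` (`ι ≥ 1∕N`), the block family and the companion condition read through `siteCast h`. [folklore]
[cite: Balaban1985BackgroundPropagators, (3.49) p.399, (3.101) p.414] -/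
theorem norm_bondBlock_le_exp_of_uniform_circle_bound_cast {P : Fin d → ℕ} {N : ℕ} [NeZero N] (h : P = fineP N m) (hm : ∀ i, 1 ≤ m i)
    (T : BondL2K ℂ d P c₀ W →L[ℂ] BondL2K ℂ d P c₀ W)
    {PB : TSite d m → BondL2K ℂ d P c₀ W →L[ℂ] BondL2K ℂ d P c₀ W}
    (hPB : ∀ (y : TSite d m) (f : BondL2K ℂ d P c₀ W) (b : Bond d P),
      WL2.equiv ℂ (fun _ : Bond d P => c₀) W (PB y f) b =
        if blockCoord N m (siteCast h (bpos b)) = y then WL2.equiv ℂ (fun _ : Bond d P => c₀) W f b else 0)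
    {r C ι ℓ' : ℝ} (hr : 0 ≤ r) (hC0 : 0 ≤ C) (hι : 1 / (N : ℝ) ≤ ι) (hℓ' : 1 ≤ ℓ')
    (hC : ∀ (χ : TSite d P → ℝ) (χ' : TSite d m → ℝ),
      (∀ b : Bond d P, |χ (bpos b) - χ (btgt b)| ≤ ι) →
      (∀ (y : TSite d m) (x : TSite d P), siteCast h x ∈ B9Eq319QprimeTorus.blockOf N m y → |χ' y - χ x| ≤ ℓ') →
      ∀ (MB : BondL2K ℂ d P c₀ W →L[ℂ] BondL2K ℂ d P c₀ W),
      (∀ (f : BondL2K ℂ d P c₀ W) (b : Bond d P),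
        WL2.equiv ℂ (fun _ : Bond d P => c₀) W (MB f) b = (χ (bpos b) : ℂ) • WL2.equiv ℂ (fun _ : Bond d P => c₀) W f b) →
      ∀ κ : ℂ, ‖κ‖ = r → ‖exp (κ • MB) ∘L T ∘L exp (κ • (-MB))‖ ≤ C)
    (y₀ y₁ : TSite d m) :
    ‖PB y₁ ∘L T ∘L PB y₀‖ ≤ C * Real.exp r * Real.exp (-(r * tdist m y₀ y₁)) := by
  subst h
  simp only [siteCast_rfl, Equiv.refl_apply] at hPB hC
  exact norm_bondBlock_le_exp_of_uniform_circle_bound N m hm T hPB hr hC0 hι hℓ' (fun χ χ' hχ hχ' => hC χ χ' hχ fun y x hx => hχ' y x hx) y₀ y₁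

end Literature.MathematicalPhysics.QuantumFieldTheory.Balaban1983to89.B9Eq349BondBlockDecayFromCircle

end
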